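import Summits.CriticalPhenomena.PercolationContinuityZ3.Theorems.PercNearOneGluingNoHeavyLowerTailChampionStability
import Literature.Probability.Percolation.LonelyClusterExchange
import Literature.Probability.Percolation.OpenGraphCuts
import HarnessLib

/-!
# `NoHeavyLowerTail` (stmt-CriticalPhenomena-4575) — greedy-comparator induction: TOOLS
# (absorption of a vertex into an observer set, one-bond step, switch identity, base case, relay branch)

Support file (lemma factory `prim-lf-6`, observer-set technique; `--supports stmt-CriticalPhenomena-4575`).  No definitions,
no named facts, no sorries.  Consumed by `…NoHeavyLowerTailGreedyComparator.lean`, which proves that the GREEDY COMPARATOR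
CONDITION on champions implies the cumulative isolation lemma and hence the crux; the module docstring there has the argument.

Notation.  `μ_w = prodBernoulli w` on `Fin n`, relays `A`, level `j`, `π(v) = {x ∈ A : v ↔ x}`, `I_w(v) = μ_w{|π(v)| ≤ j}`
(LIGHTNESS), a CHAMPION maximises `I_w` over `A`.  For a finite vertex set `T` ("observer set"): `v ≁ T` = `∀ t ∈ T, v ↮ t`,
`π(T) = {x ∈ A : ∃ t ∈ T, t ↔ x}`,
  `E₁(T,v) = {v ≁ T, |π(v)| ≤ j}`, `E₂(T,v) = {v ≁ T, 1 ≤ |π(T)| ≤ j}`, `E₃(T,a) = {|π(T)| = 0, |π(a)| ≤ j}`, `Q(T,v) = {v ~ T, |π(T)| ≤ j}`.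
Contents: (i) opening the boundary pair `s(y,z)` (`y ∈ T`, `z ∉ T`) pulls `E₁(T,·), E₂(T,·), E₃(T,·), Q(T,·)` back to the same
events for `T ∪ {z}` (`preimage_insert_*`, from `ChampionStability.reachable_insert_iff`); (ii) hence the ONE-BOND STEP WITH
ABSORPTION `μ_w(S) = (1 − w e) μ_{w[e↦0]}(S) + (w e) μ_{w[e↦0]}(S')` (`real_eq_oneBond_shift`, via `stub_oneBondDecomp_k15` and
`tieLiftOne_real_one_eq`); (iii) the SWITCH identity `μE₂(T,v) = μ{1 ≤ |π(T)| ≤ j} − μQ(T,v)` for a relay `v` (`real_E2_eq`);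
(iv) the BASE CASE (no positive boundary pair: nothing leaves `T` a.s., `not_reachable_openGraph_of_closed_cut`) and
(v) the RELAY BRANCH (`T` contains a relay: `E₃ = ∅` and `μE₂ ≤ μE₁` is van den Berg–Häggström–Kahn's observer-set transfer
`Literature.Probability.Percolation.observerSet_le_of_lonelier`) of the inequality `μE₁(T,i) − μE₂(T,i) − μE₃(T,a) ≥ 0`.
-/
noncomputable section

namespace Summit.CriticalPhenomena.PercolationContinuityZ3.Theorems

open MeasureTheory Set Literature.Probability.LatticeModels Literature.Probability.Percolation
open scoped Classical BigOperators

variable {n : ℕ}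

namespace GreedyComparator

open ChampionStability

/-! ### Absorbing `z` into the observer set = opening the boundary pair `s(y,z)` -/

/-- After opening `s(y,z)` (`y ∈ T`, `y ≠ z`): `v` avoids `T` iff `v` avoided `T ∪ {z}` before. [folklore] -/
theorem forall_not_reach_insert_iff (ω : BondConfig (Fin n)) {y z : Fin n} (hyz : y ≠ z) (T : Finset (Fin n))
    (hy : y ∈ T) (v : Fin n) :
    (∀ t ∈ T, ¬ (openGraph (insert s(y, z) ω)).Reachable v t) ↔
      (∀ t ∈ insert z T, ¬ (openGraph ω).Reachable v t) := by
  constructor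
  · intro h t ht
    rcases Finset.mem_insert.1 ht with rfl | ht'
    · intro hvz
      apply h y hy
      rw [reachable_insert_iff ω hyz]
      exact Or.inr ⟨⟨t, by simp, hvz⟩, ⟨y, by simp, SimpleGraph.Reachable.refl y⟩⟩
    · intro hvt
      apply h t ht'
      rw [reachable_insert_iff ω hyz]
      exact Or.inl hvt
  · intro h t ht hvt
    rw [reachable_insert_iff ω hyz] at hvt
    rcases hvt with hvt | ⟨⟨s, hs, hvs⟩, -⟩
    · exact h t (Finset.mem_insert_of_mem ht) hvt
    · simp only [Finset.mem_insert, Finset.mem_singleton] at hs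
      rcases hs with rfl | rfl
      · exact h s (Finset.mem_insert_of_mem hy) hvs
      · exact h s (Finset.mem_insert_self _ _) hvs

/-- After opening `s(y,z)` (`y ∈ T`, `y ≠ z`): `v` reaches `T` iff `v` reached `T ∪ {z}` before. [folklore] -/
theorem exists_reach_insert_iff (ω : BondConfig (Fin n)) {y z : Fin n} (hyz : y ≠ z) (T : Finset (Fin n))
    (hy : y ∈ T) (v : Fin n) :
    (∃ t ∈ T, (openGraph (insert s(y, z) ω)).Reachable v t) ↔
      (∃ t ∈ insert z T, (openGraph ω).Reachable v t) := by
  have h := forall_not_reach_insert_iff ω hyz T hy v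
  constructor
  · intro ⟨t, ht, hvt⟩
    by_contra hne
    push Not at hne
    exact (h.2 hne) t ht hvt
  · intro ⟨t, ht, hvt⟩
    by_contra hne
    push Not at hne
    exact (h.1 hne) t ht hvt

/-- After opening `s(y,z)` (`y ∈ T`, `y ≠ z`): the relays reached from `T` are the relays reached from `T ∪ {z}` before.
[folklore] -/
theorem filter_reachSet_insert_eq (ω : BondConfig (Fin n)) {y z : Fin n} (hyz : y ≠ z) (T A : Finset (Fin n))
    (hy : y ∈ T) :
    (A.filter fun x => ∃ t ∈ T, insert s(y, z) ω ∈ openConn t x) =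
      (A.filter fun x => ∃ t ∈ insert z T, ω ∈ openConn t x) := by
  apply Finset.filter_congr
  intro x _
  simp only [mem_openConn_iff_reachable]
  constructor
  · rintro ⟨t, ht, htx⟩
    have := (exists_reach_insert_iff ω hyz T hy x).1 ⟨t, ht, htx.symm⟩
    obtain ⟨t', ht', hxt'⟩ := this
    exact ⟨t', ht', hxt'.symm⟩
  · rintro ⟨t, ht, htx⟩
    obtain ⟨t', ht', hxt'⟩ := (exists_reach_insert_iff ω hyz T hy x).2 ⟨t, ht, htx.symm⟩
    exact ⟨t', ht', hxt'.symm⟩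

/-- A vertex avoiding `T ∪ {z}` keeps its relay set when `s(y,z)` (`y ∈ T`) is opened. [folklore] -/
theorem filter_reach_insert_eq_of_forall_not (ω : BondConfig (Fin n)) {y z : Fin n} (hyz : y ≠ z)
    (T A : Finset (Fin n)) (hy : y ∈ T) (v : Fin n) (hv : ∀ t ∈ insert z T, ¬ (openGraph ω).Reachable v t) :
    (A.filter fun x => insert s(y, z) ω ∈ openConn v x) = (A.filter fun x => ω ∈ openConn v x) := by
  apply Finset.filter_congr
  intro x _
  simp only [mem_openConn_iff_reachable]
  exact reachable_insert_iff_of_not ω hyz (hv y (Finset.mem_insert_of_mem hy)) (hv z (Finset.mem_insert_self _ _)) x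


/-! ### Preimages of the four events under `ω ↦ insert s(y,z) ω` -/

/-- Preimage of `E₁(T,v) = {v ≁ T, |π(v)| ≤ j}` under opening `s(y,z)` is `E₁(T ∪ {z}, v)`. [folklore] -/
theorem preimage_insert_E1 {y z : Fin n} (hyz : y ≠ z) (T A : Finset (Fin n)) (hy : y ∈ T) (v : Fin n) (j : ℕ) :
    (fun ω : BondConfig (Fin n) => insert s(y, z) ω) ⁻¹'
        {ω : BondConfig (Fin n) | (∀ t ∈ T, ω ∉ openConn v t) ∧ (A.filter fun x => ω ∈ openConn v x).card ≤ j} =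
      {ω : BondConfig (Fin n) | (∀ t ∈ insert z T, ω ∉ openConn v t) ∧
        (A.filter fun x => ω ∈ openConn v x).card ≤ j} := by
  ext ω
  simp only [mem_preimage, mem_setOf_eq, mem_openConn_iff_reachable]
  constructor
  · rintro ⟨h1, h2⟩
    have h1' := (forall_not_reach_insert_iff ω hyz T hy v).1 h1
    refine ⟨h1', ?_⟩
    have := filter_reach_insert_eq_of_forall_not ω hyz T A hy v h1'
    simp only [mem_openConn_iff_reachable] at this
    rwa [this] at h2
  · rintro ⟨h1, h2⟩
    refine ⟨(forall_not_reach_insert_iff ω hyz T hy v).2 h1, ?_⟩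
    have := filter_reach_insert_eq_of_forall_not ω hyz T A hy v h1
    simp only [mem_openConn_iff_reachable] at this
    rwa [this]

/-- Preimage of `E₂(T,v) = {v ≁ T, 1 ≤ |π(T)| ≤ j}` under opening `s(y,z)` is `E₂(T ∪ {z}, v)`. [folklore] -/
theorem preimage_insert_E2 {y z : Fin n} (hyz : y ≠ z) (T A : Finset (Fin n)) (hy : y ∈ T) (v : Fin n) (j : ℕ) :
    (fun ω : BondConfig (Fin n) => insert s(y, z) ω) ⁻¹'
        {ω : BondConfig (Fin n) | (∀ t ∈ T, ω ∉ openConn v t) ∧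
          1 ≤ (A.filter fun x => ∃ t ∈ T, ω ∈ openConn t x).card ∧
          (A.filter fun x => ∃ t ∈ T, ω ∈ openConn t x).card ≤ j} =
      {ω : BondConfig (Fin n) | (∀ t ∈ insert z T, ω ∉ openConn v t) ∧
          1 ≤ (A.filter fun x => ∃ t ∈ insert z T, ω ∈ openConn t x).card ∧
          (A.filter fun x => ∃ t ∈ insert z T, ω ∈ openConn t x).card ≤ j} := by
  ext ω
  simp only [mem_preimage, mem_setOf_eq]
  rw [filter_reachSet_insert_eq ω hyz T A hy]
  simp only [mem_openConn_iff_reachable]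
  rw [forall_not_reach_insert_iff ω hyz T hy v]

/-- Preimage of `E₃(T,a) = {|π(T)| = 0, |π(a)| ≤ j}` (`a ∈ A`) under opening `s(y,z)` is `E₃(T ∪ {z}, a)`. [folklore] -/
theorem preimage_insert_E3 {y z : Fin n} (hyz : y ≠ z) (T A : Finset (Fin n)) (hy : y ∈ T) {a : Fin n} (ha : a ∈ A)
    (j : ℕ) :
    (fun ω : BondConfig (Fin n) => insert s(y, z) ω) ⁻¹'
        {ω : BondConfig (Fin n) | (A.filter fun x => ∃ t ∈ T, ω ∈ openConn t x).card = 0 ∧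
          (A.filter fun x => ω ∈ openConn a x).card ≤ j} =
      {ω : BondConfig (Fin n) | (A.filter fun x => ∃ t ∈ insert z T, ω ∈ openConn t x).card = 0 ∧
          (A.filter fun x => ω ∈ openConn a x).card ≤ j} := by
  ext ω
  simp only [mem_preimage, mem_setOf_eq]
  rw [filter_reachSet_insert_eq ω hyz T A hy]
  constructor
  · rintro ⟨h1, h2⟩
    refine ⟨h1, ?_⟩
    have hnot : ∀ t ∈ insert z T, ¬ (openGraph ω).Reachable a t := by
      intro t ht hat
      have hmem : a ∈ A.filter fun x => ∃ t ∈ insert z T, ω ∈ openConn t x :=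
        Finset.mem_filter.2 ⟨ha, t, ht, (mem_openConn_iff_reachable ω t a).2 hat.symm⟩
      rw [Finset.card_eq_zero] at h1
      rw [h1] at hmem
      exact Finset.notMem_empty a hmem
    have := filter_reach_insert_eq_of_forall_not ω hyz T A hy a hnot
    rwa [this] at h2
  · rintro ⟨h1, h2⟩
    refine ⟨h1, ?_⟩
    have hnot : ∀ t ∈ insert z T, ¬ (openGraph ω).Reachable a t := by
      intro t ht hat
      have hmem : a ∈ A.filter fun x => ∃ t ∈ insert z T, ω ∈ openConn t x :=
        Finset.mem_filter.2 ⟨ha, t, ht, (mem_openConn_iff_reachable ω t a).2 hat.symm⟩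
      rw [Finset.card_eq_zero] at h1
      rw [h1] at hmem
      exact Finset.notMem_empty a hmem
    have := filter_reach_insert_eq_of_forall_not ω hyz T A hy a hnot
    rwa [this]

/-- Preimage of `Q(T,v) = {v ~ T, |π(T)| ≤ j}` under opening `s(y,z)` is `Q(T ∪ {z}, v)`. [folklore] -/
theorem preimage_insert_Q {y z : Fin n} (hyz : y ≠ z) (T A : Finset (Fin n)) (hy : y ∈ T) (v : Fin n) (j : ℕ) :
    (fun ω : BondConfig (Fin n) => insert s(y, z) ω) ⁻¹'
        {ω : BondConfig (Fin n) | (∃ t ∈ T, ω ∈ openConn v t) ∧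
          (A.filter fun x => ∃ t ∈ T, ω ∈ openConn t x).card ≤ j} =
      {ω : BondConfig (Fin n) | (∃ t ∈ insert z T, ω ∈ openConn v t) ∧
          (A.filter fun x => ∃ t ∈ insert z T, ω ∈ openConn t x).card ≤ j} := by
  ext ω
  simp only [mem_preimage, mem_setOf_eq]
  rw [filter_reachSet_insert_eq ω hyz T A hy]
  simp only [mem_openConn_iff_reachable]
  rw [exists_reach_insert_iff ω hyz T hy v]

/-! ### One-bond step with absorption -/

/-- **One-bond step with absorption.**  If the preimage of `S` under opening `e` is `S'`, then
`μ_w(S) = (1 − w e)·μ_{w[e↦0]}(S) + (w e)·μ_{w[e↦0]}(S')`. [folklore] -/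
theorem real_eq_oneBond_shift (w : Sym2 (Fin n) → unitInterval) (e : Sym2 (Fin n))
    (S S' : Set (BondConfig (Fin n))) (h : (fun ω : BondConfig (Fin n) => insert e ω) ⁻¹' S = S') :
    (prodBernoulli w).real S =
      (1 - (w e : ℝ)) * (prodBernoulli (Function.update w e 0)).real S +
        (w e : ℝ) * (prodBernoulli (Function.update w e 0)).real S' := by
  rw [stub_oneBondDecomp_k15 n w e S, tieLiftOne_real_one_eq w e S, h]

/-! ### The switch identity: `E₂(T,v) = {1 ≤ |π(T)| ≤ j} ∖ Q(T,v)` for a relay `v` -/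

/-- For a relay `v ∈ A`: `μ E₂(T,v) = μ{1 ≤ |π(T)| ≤ j} − μ Q(T,v)`. [folklore] -/
theorem real_E2_eq (μ : Measure (BondConfig (Fin n))) [IsFiniteMeasure μ] (T A : Finset (Fin n)) {v : Fin n}
    (hv : v ∈ A) (j : ℕ) :
    μ.real {ω : BondConfig (Fin n) | (∀ t ∈ T, ω ∉ openConn v t) ∧
          1 ≤ (A.filter fun x => ∃ t ∈ T, ω ∈ openConn t x).card ∧
          (A.filter fun x => ∃ t ∈ T, ω ∈ openConn t x).card ≤ j} =
      μ.real {ω : BondConfig (Fin n) | 1 ≤ (A.filter fun x => ∃ t ∈ T, ω ∈ openConn t x).card ∧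
          (A.filter fun x => ∃ t ∈ T, ω ∈ openConn t x).card ≤ j} -
        μ.real {ω : BondConfig (Fin n) | (∃ t ∈ T, ω ∈ openConn v t) ∧
          (A.filter fun x => ∃ t ∈ T, ω ∈ openConn t x).card ≤ j} := by
  set P : Set (BondConfig (Fin n)) := {ω | 1 ≤ (A.filter fun x => ∃ t ∈ T, ω ∈ openConn t x).card ∧
      (A.filter fun x => ∃ t ∈ T, ω ∈ openConn t x).card ≤ j} with hP
  set Qv : Set (BondConfig (Fin n)) := {ω | (∃ t ∈ T, ω ∈ openConn v t) ∧
      (A.filter fun x => ∃ t ∈ T, ω ∈ openConn t x).card ≤ j} with hQv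
  have hmeas : ∀ S : Set (BondConfig (Fin n)), MeasurableSet S := fun S => (Set.toFinite S).measurableSet
  have hsub : Qv ⊆ P := by
    intro ω hω
    obtain ⟨⟨t, ht, hvt⟩, hcard⟩ := hω
    refine ⟨?_, hcard⟩
    apply Finset.card_pos.2
    exact ⟨v, Finset.mem_filter.2 ⟨hv, t, ht, (mem_openConn_iff_reachable ω t v).2
      ((mem_openConn_iff_reachable ω v t).1 hvt).symm⟩⟩
  have hset : {ω : BondConfig (Fin n) | (∀ t ∈ T, ω ∉ openConn v t) ∧
      1 ≤ (A.filter fun x => ∃ t ∈ T, ω ∈ openConn t x).card ∧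
      (A.filter fun x => ∃ t ∈ T, ω ∈ openConn t x).card ≤ j} = P \ Qv := by
    ext ω
    simp only [hP, hQv, mem_sdiff, mem_setOf_eq, not_and, not_le]
    constructor
    · rintro ⟨h1, h2, h3⟩
      exact ⟨⟨h2, h3⟩, fun ⟨t, ht, hvt⟩ => absurd hvt (h1 t ht)⟩
    · rintro ⟨⟨h2, h3⟩, h4⟩
      refine ⟨fun t ht hvt => ?_, h2, h3⟩
      exact absurd h3 (not_le.2 (h4 ⟨t, ht, hvt⟩))
  rw [hset, measureReal_sdiff hsub (hmeas _)]


/-! ### Base case: no positive boundary pair -/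

/-- **Base case.**  If `T` is disjoint from `A` and every boundary pair of `T` has weight `0`, then for a champion `i` and
any relay `a`: `μE₁(T,i) − μE₂(T,i) − μE₃(T,a) ≥ 0` (indeed `μE₂ = 0`, `μE₁ = I(i) ≥ I(a) ≥ μE₃`). [folklore] -/
theorem base_nonneg (w : Sym2 (Fin n) → unitInterval) (T A : Finset (Fin n)) (hTA : Disjoint T A) {i a : Fin n}
    (hi : i ∈ A) (ha : a ∈ A) (j : ℕ)
    (hchamp : ∀ b ∈ A, (prodBernoulli w).real {ω : BondConfig (Fin n) | (A.filter fun x => ω ∈ openConn b x).card ≤ j} ≤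
      (prodBernoulli w).real {ω : BondConfig (Fin n) | (A.filter fun x => ω ∈ openConn i x).card ≤ j})
    (hbd : ∀ y ∈ T, ∀ z, z ∉ T → (w s(y, z) : ℝ) = 0) :
    0 ≤ (prodBernoulli w).real {ω : BondConfig (Fin n) | (∀ t ∈ T, ω ∉ openConn i t) ∧
            (A.filter fun x => ω ∈ openConn i x).card ≤ j} -
        (prodBernoulli w).real {ω : BondConfig (Fin n) | (∀ t ∈ T, ω ∉ openConn i t) ∧
            1 ≤ (A.filter fun x => ∃ t ∈ T, ω ∈ openConn t x).card ∧
            (A.filter fun x => ∃ t ∈ T, ω ∈ openConn t x).card ≤ j} -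
        (prodBernoulli w).real {ω : BondConfig (Fin n) | (A.filter fun x => ∃ t ∈ T, ω ∈ openConn t x).card = 0 ∧
            (A.filter fun x => ω ∈ openConn a x).card ≤ j} := by
  set μ := prodBernoulli w with hμ
  set F : Finset (Sym2 (Fin n)) :=
    ((Finset.univ : Finset (Fin n × Fin n)).filter fun q => q.1 ∈ T ∧ q.2 ∉ T).image fun q => s(q.1, q.2) with hF
  set Bad : Set (BondConfig (Fin n)) := {ω | ∃ e ∈ F, e ∈ ω} with hBad
  have hmeas : ∀ S : Set (BondConfig (Fin n)), MeasurableSet S := fun S => (Set.toFinite S).measurableSet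
  have hBad0 : μ.real Bad = 0 := by
    have h0 : μ Bad = 0 := by
      refine prodBernoulli_setOf_exists_mem_eq_zero w F fun e he => ?_
      obtain ⟨q, hq, rfl⟩ := Finset.mem_image.1 he
      obtain ⟨hq1, hq2⟩ := (Finset.mem_filter.1 hq).2
      exact hbd q.1 hq1 q.2 hq2
    rw [measureReal_def, h0, ENNReal.toReal_zero]
  -- off `Bad`, nothing leaves `T`
  have hcut : ∀ ω : BondConfig (Fin n), ω ∉ Bad → ∀ t ∈ T, ∀ x, x ∉ T → ¬ (openGraph ω).Reachable t x := by
    intro ω hω t ht x hx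
    refine not_reachable_openGraph_of_closed_cut ω (↑T : Set (Fin n)) (Finset.mem_coe.2 ht)
      (fun h => hx (Finset.mem_coe.1 h)) fun u hu v hv huv => hω ?_
    refine ⟨s(u, v), Finset.mem_image.2 ⟨(u, v), Finset.mem_filter.2 ⟨Finset.mem_univ _, Finset.mem_coe.1 hu,
      fun h => hv (Finset.mem_coe.2 h)⟩, rfl⟩, huv⟩
  have hiT : i ∉ T := fun h => Finset.disjoint_left.1 hTA h hi
  -- `E₂ ⊆ Bad`
  have hE2 : μ.real {ω : BondConfig (Fin n) | (∀ t ∈ T, ω ∉ openConn i t) ∧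
      1 ≤ (A.filter fun x => ∃ t ∈ T, ω ∈ openConn t x).card ∧
      (A.filter fun x => ∃ t ∈ T, ω ∈ openConn t x).card ≤ j} ≤ 0 := by
    rw [← hBad0]
    refine measureReal_mono (fun ω hω => ?_) (measure_ne_top _ _)
    obtain ⟨-, h1, -⟩ := hω
    obtain ⟨x, hx⟩ := Finset.card_pos.1 (by omega : 0 < (A.filter fun x => ∃ t ∈ T, ω ∈ openConn t x).card)
    obtain ⟨hxA, t, ht, htx⟩ := Finset.mem_filter.1 hx
    by_contra hω'
    exact hcut ω hω' t ht x (fun h => Finset.disjoint_left.1 hTA h hxA) htx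
  -- `{|π(i)| ≤ j} ⊆ E₁ ∪ Bad`
  have hE1 : μ.real {ω : BondConfig (Fin n) | (A.filter fun x => ω ∈ openConn i x).card ≤ j} ≤
      μ.real {ω : BondConfig (Fin n) | (∀ t ∈ T, ω ∉ openConn i t) ∧ (A.filter fun x => ω ∈ openConn i x).card ≤ j} +
        μ.real Bad := by
    calc μ.real {ω : BondConfig (Fin n) | (A.filter fun x => ω ∈ openConn i x).card ≤ j}
        ≤ μ.real ({ω : BondConfig (Fin n) | (∀ t ∈ T, ω ∉ openConn i t) ∧
            (A.filter fun x => ω ∈ openConn i x).card ≤ j} ∪ Bad) := by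
          refine measureReal_mono (fun ω hω => ?_) (measure_ne_top _ _)
          by_cases hb : ω ∈ Bad
          · exact Or.inr hb
          · refine Or.inl ⟨fun t ht hit => hcut ω hb t ht i hiT ?_, hω⟩
            exact ((mem_openConn_iff_reachable ω i t).1 hit).symm
      _ ≤ _ := measureReal_union_le _ _
  -- `E₃ ⊆ {|π(a)| ≤ j}`
  have hE3 : μ.real {ω : BondConfig (Fin n) | (A.filter fun x => ∃ t ∈ T, ω ∈ openConn t x).card = 0 ∧
      (A.filter fun x => ω ∈ openConn a x).card ≤ j} ≤
      μ.real {ω : BondConfig (Fin n) | (A.filter fun x => ω ∈ openConn a x).card ≤ j} :=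
    measureReal_mono (fun ω hω => hω.2) (measure_ne_top _ _)
  have ha' := hchamp a ha
  linarith

/-! ### The Theorem-A branch: the absorbed vertex is a relay -/

/-- **Relay branch.**  If the observer set `T'` contains a relay `r` and `i₁` is a champion, then
`μE₁(T',i₁) − μE₂(T',i₁) − μE₃(T',a) ≥ 0`: `E₃ = ∅` and `μE₂ ≤ μE₁` is the observer-set transfer of van den
Berg–Häggström–Kahn (`observerSet_le_of_lonelier`, `r` no lonelier than the champion).
[cite: VandenbergHaggstromKahn2005, Thm. 1.5 (p. 7) — via Literature.Probability.Percolation.observerSet_le_of_lonelier] -/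
theorem relay_branch_nonneg (w : Sym2 (Fin n) → unitInterval) (T' A : Finset (Fin n)) {r i₁ a : Fin n}
    (hrT : r ∈ T') (hrA : r ∈ A) (j : ℕ)
    (hchamp : ∀ b ∈ A, (prodBernoulli w).real {ω : BondConfig (Fin n) | (A.filter fun x => ω ∈ openConn b x).card ≤ j} ≤
      (prodBernoulli w).real {ω : BondConfig (Fin n) | (A.filter fun x => ω ∈ openConn i₁ x).card ≤ j}) :
    0 ≤ (prodBernoulli w).real {ω : BondConfig (Fin n) | (∀ t ∈ T', ω ∉ openConn i₁ t) ∧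
            (A.filter fun x => ω ∈ openConn i₁ x).card ≤ j} -
        (prodBernoulli w).real {ω : BondConfig (Fin n) | (∀ t ∈ T', ω ∉ openConn i₁ t) ∧
            1 ≤ (A.filter fun x => ∃ t ∈ T', ω ∈ openConn t x).card ∧
            (A.filter fun x => ∃ t ∈ T', ω ∈ openConn t x).card ≤ j} -
        (prodBernoulli w).real {ω : BondConfig (Fin n) | (A.filter fun x => ∃ t ∈ T', ω ∈ openConn t x).card = 0 ∧
            (A.filter fun x => ω ∈ openConn a x).card ≤ j} := by
  have hE3 : {ω : BondConfig (Fin n) | (A.filter fun x => ∃ t ∈ T', ω ∈ openConn t x).card = 0 ∧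
      (A.filter fun x => ω ∈ openConn a x).card ≤ j} = ∅ := by
    ext ω
    simp only [mem_setOf_eq, mem_empty_iff_false, iff_false, not_and]
    intro h0
    exfalso
    have hmem : r ∈ A.filter fun x => ∃ t ∈ T', ω ∈ openConn t x :=
      Finset.mem_filter.2 ⟨hrA, r, hrT, (mem_openConn_iff_reachable ω r r).2 (SimpleGraph.Reachable.refl r)⟩
    rw [Finset.card_eq_zero] at h0
    rw [h0] at hmem
    exact Finset.notMem_empty r hmem
  have hA := observerSet_le_of_lonelier w A T' r i₁ hrT j (hchamp r hrA)
  rw [hE3, measureReal_empty, sub_zero, sub_nonneg]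
  convert hA using 7
  all_goals exact congrArg Finset.card (@Finset.filter_congr _ _ _ (_) (_) _ fun _ _ => Iff.rfl)

end GreedyComparator

end Summit.CriticalPhenomena.PercolationContinuityZ3.Theorems

end
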